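import Literature.NumberTheory.EllipticCurves.IsogenyKummerSequenceProofs
import HarnessLib

/-!
# Cassels' formula for the Selmer ratio of an isogeny of ANY degree
# (Cassels 1965 VIII; Milne, *Arithmetic Duality Theorems*, I (7.3.1))

Literature-typing file (INPUTS desk row τ4 / X2a, unit `bsd-input-ty-cassels`; "typed ≠ proved ≠
endorsed").  The tree's named fact
`Literature.NumberTheory.EllipticCurves.BhargavaKlagsbrunLemkeOliverShnidman2019.casselsFormula_selmerRatio`
(`IsogenySelmerGroups.lean`) is Cassels' formula
`c(φ) · #Sel_{φ̂}(E') · #E[φ](K) = #Sel_φ(E) · #E'[φ̂](K)` for `3`-ISOGENIES only (as displayed in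
BKLOS §9.1 (9.2)), with its own `TODO(general form)`.  The consumers of Cassels' isogeny-invariance
theorem (`WeierstrassCurve.bsdRHS_eq_of_isIsogenous_of_casselsTate_adjoint_of_casselsFormula`,
`BSDQuadraticDescentCasselsSelmerRatioProofs.lean`, hypothesis `hCF`) need it for EVERY isogeny over
`ℚ`.  This file types the general statement — every isogeny of elliptic curves over every number
field — in the SAME vocabulary (`BhargavaKlagsbrunLemkeOliverShnidman2019.selmerRatio`,
`WeierstrassCurve.Isogeny.selmerGroup`, `WeierstrassCurve.Isogeny.ratKerCard`; no new carrier), and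
PROVES that the degree-`3` fact and the consumers' `hCF` are instances of it.

## The printed statement and its currency

> **Milne, *ADT*, I §7, proof of Thm. 7.3, display (7.3.1)** (author's PDF pp. 98–100; quoted
> verbatim by Dokchitser–Dokchitser, Ann. of Math. 172 (2010) §4.1, proof of Thm. 4.3, held
> `paper:arxiv-math_0610290` chunk p0011: "For a sufficiently large set of places `S` of `K`
> ([MilA] I.(7.3.1)), `∏_{v∈S} z(φ(K_v)) = z(φ(K))/z(φᵗ(K)) · |Ш[φᵗ]|/|Ш[φ]|`").  Setting: `K` a
> number field, `f : A → B` an isogeny of abelian varieties over `K`, `fᵗ : Bᵗ → Aᵗ` its dual, `S`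
> finite containing the archimedean primes, the primes of bad reduction and the primes dividing
> `deg f`; `z(h) = [Ker h]/[Coker h]`; then
> `∏_{v∈S} z(f(K_v)) = ([Ker Ш(fᵗ)]/[Ker Ш(f)]) · z(f(K))/z(fᵗ(K))`      (7.3.1)
> proved there from Poitou–Tate duality (I Thm. 4.10), local duality and the global Euler
> characteristic (I Thm. 5.1); Milne, Notes to I.§7: "For elliptic curves, Theorem 7.3 was proved
> by Cassels (1965)."

For an isogeny `φ : E → E'` of ELLIPTIC curves (`E ≅ Eᵗ`, `E' ≅ E'ᵗ`, `fᵗ = φ̂` the dual isogeny,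
`φ̂ ∘ φ = [deg φ]`): `z(φ(K_v))⁻¹ = #coker φ(K_v)/#ker φ(K_v) = c_v(φ)` is the LOCAL SELMER RATIO
(`Isogeny.localSelmerRatio`; BKLOS §2), `c_v(φ) = 1` off `S` (Schaefer, J. Number Theory 56 (1996)
L. 3.8; Shnidman Cor. 3.2), so `∏_{v∈S} z(φ(K_v))⁻¹ = c(φ) = ∏_{v ≤ ∞} c_v(φ)`
(`BhargavaKlagsbrunLemkeOliverShnidman2019.selmerRatio`); `[Ker φ(K)] = #E[φ](K)`
(`Isogeny.ratKerCard`, tree theorem `Isogeny.natCard_ker_pointHom_eq_ratKerCard`),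
`[Ker Ш(φ)] = #Ш(E/K)[φ]`, and by Silverman X.4.2(a) (tree theorem `Isogeny.natCard_selmerGroup_eq`)
`#Sel_φ(E/K) = [Coker φ(K)] · [Ker Ш(φ)]`.  Substituting, (7.3.1) is literally
**`c(φ) · #Sel_{φ̂}(E'/K) · #E[φ](K) = #Sel_φ(E/K) · #E'[φ̂](K)`** — "Cassels' formula":
BKLOS §9.1 (9.2) "`c(φ) = |Sel_φ(E)| |E'[φ̂](F)| / (|Sel_{φ̂}(E')| |E[φ](F)|)` [Cassels8]";
Klagsbrun–Lemke Oliver 2014 Thm. 3.3 "(Cassels) `𝒯(E/E') = |Sel_φ|/|Sel_{φ̂}| = ∏_v |H¹_φ(ℚ_v, C)|/2`"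
(2-isogenies over `ℚ`; "a combination of Theorem 1.1 and equations (1.22) and (3.4) in
[Cassels1965]"); Miller–Stoll 2013 §6 (`ℓ`-isogenies over `ℚ`, local side evaluated);
Shnidman, IMRN 2021, Thm. 4.1 and proof ("by Wiles' duality formula"; "In the case of elliptic
curves, all results in this section are due to Cassels [Cassels8]").  The tree's kernel-checked
converse bookkeeping `Isogeny.keyIdentity_of_casselsFormula` (Cassels' formula ⟹ (7.3.1)) is in
`BSDQuadraticDescentCasselsSelmerRatioProofs.lean`.

## Contents

* §1 NAMED FACT `Cassels1965.selmerRatioFormula` (REFEREED; `TODO(general form)`: abelian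
  varieties, Milne I Thm. 7.3 — no `φ`-Selmer vocabulary for them in the tree).  Net debt `+1`;
  no `_holds` this generation: the printed proof is Poitou–Tate duality for the finite module
  `E[φ]` with the orthogonality of the local Kummer conditions of `φ` and `φ̂` (Milne I 4.10 + 5.1;
  Wiles' formula, Darmon–Diamond–Taylor Thm. 2.19) — the tree has the Selmer-structure count
  `Literature.NumberTheory.GaloisCohomology.natCard_selmerQuotient_mul_of_poitouTate` but neither
  Wiles' formula nor the bridge `Isogeny.selmerGroup ↔ SelmerStructure` for `E[φ]` nor the local
  orthogonality (Cassels VIII (7.15)).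
* §2 PROVED: the degree-`3` fact is an instance (`casselsFormula_selmerRatio_of_selmerRatioFormula`);
  the consumers' hypothesis `hCF` over `ℚ` verbatim (`selmerRatioFormula.rat`); `c(φ) c(φ̂) = 1`
  for a dual pair of any degree (`selmerRatio_mul_selmerRatio_eq_one_of_dual`, BKLOS §9.1 p0014 L39
  / Shnidman Cor. 3.5 with `c([n]) = 1`); the quotient ("Tamagawa ratio") form
  `#Sel_φ/#Sel_{φ̂} = c(φ) · #E[φ](K)/#E'[φ̂](K)` (Klagsbrun–Lemke Oliver Def. 3.1 / Thm. 3.3).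

## References

* [Cassels1965ArithmeticVIII] J. W. S. Cassels, *Arithmetic on curves of genus 1. VIII*, J. reine
  angew. Math. 217 (1965) 180–199, Thm. 1.1 with (1.22), (3.4) (original NOT held — cite-only,
  acq-00278; located through the restatements below).
* [MilneADT2006] J. S. Milne, *Arithmetic Duality Theorems*, 2nd ed., I.§7 Thm. 7.3 and proof,
  (7.3.1), pp. 97–100, Notes p. 101 (read: author's PDF `paper:url-620c8c980f6e` p0105–p0109).
* [DokchitserDokchitserAnnals2010] T. and V. Dokchitser, Ann. of Math. 172 (2010), §4.1 Thm. 4.3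
  and proof (held `paper:arxiv-math_0610290`, chunk p0011: verbatim quote of (7.3.1)).
* [BhargavaKlagsbrunLemkeOliverShnidman2019] Duke Math. J. 168 (2019), §2 (c_𝔭, c(φ)), §9.1 (9.2).
* [KlagsbrunLemkeOliver2014TamagawaRatio] Z. Klagsbrun, R. J. Lemke Oliver, Res. Number Theory 2
  (2016) = arXiv:1406.6745, Def. 3.1, Thm. 3.3 (held, chunk p0005).
* [MillerStoll2013] R. L. Miller, M. Stoll, Math. Comp. 82 (2013) = arXiv:1010.3334, §6 (held p0010).
* [Shnidman2021QuadraticTwistsRM] A. Shnidman, *Quadratic twists of abelian varieties with real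
  multiplication*, IMRN 2021 = arXiv:1710.04086, §3.1, Thm. 4.1 (held, chunks p0008, p0010).
* [SilvermanAEC2009] J. H. Silverman, *AEC*, 2nd ed., Thm. X.4.2, Thm. III.6.1–6.2.
-/

noncomputable section

open scoped Classical NumberField
open WeierstrassCurve

universe u

namespace Literature.NumberTheory.EllipticCurves

open BhargavaKlagsbrunLemkeOliverShnidman2019 (selmerRatio casselsFormula_selmerRatio)

/-! ## §1 The printed statement (named fact, REFEREED) -/

namespace Cassels1965

/-- **Cassels' formula for the Selmer ratio of an isogeny (any degree, any number field).**
Milne, *ADT*, I, proof of Thm. 7.3, (7.3.1): for an isogeny `f : A → B` of abelian varieties over a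
number field `K` with dual `fᵗ`, and `S ⊇ {v ∣ ∞} ∪ {bad v} ∪ {v ∣ deg f}` finite,
"`∏_{v∈S} z(f(K_v)) = ([Ker Ш(fᵗ)]/[Ker Ш(f)]) · z(f(K))/z(fᵗ(K))`", `z(h) = [Ker h]/[Coker h]`
(quoted verbatim by Dokchitser–Dokchitser 2010, proof of Thm. 4.3; "For elliptic curves, Theorem
7.3 was proved by Cassels (1965)", Milne, Notes to I.§7).  Transcription for ELLIPTIC CURVES
(`TODO(general form)`: abelian varieties), in the currency of BKLOS §9.1 (9.2) "`c(φ) =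
|Sel_φ(E)| |E'[φ̂](F)| / (|Sel_{φ̂}(E')| |E[φ](F)|)`" = Klagsbrun–Lemke Oliver Thm. 3.3 (Cassels) =
Shnidman Thm. 4.1: `K` a number field; `φ : Isogeny V V'` between elliptic curves and
`ψ : Isogeny V' V` with `ψ ∘ φ = [deg φ]` on `E(K̄)` (so `ψ = φ̂ = fᵗ` under `E ≅ Eᵗ`, Silverman
III.6.1–6.2); `c(φ) = selmerRatio φ = ∏_{v ≤ ∞} #coker φ(K_v)/#ker φ(K_v)` (`= ∏_{v∈S} z(φ(K_v))⁻¹`,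
the factors off `S` being `1`, Schaefer 1996 L. 3.8); `#E[φ](K)`, `#E'[ψ](K)` = `Isogeny.ratKerCard`
(`= [Ker φ(K)]`, `[Ker ψ(K)]`); `#Sel_φ(E/K) = [Coker φ(K)] · [Ker Ш(φ)]` (Silverman X.4.2(a), tree
theorem `Isogeny.natCard_selmerGroup_eq`); whence (7.3.1) reads
`c(φ) · #Sel_ψ(E'/K) · #E[φ](K) = #Sel_φ(E/K) · #E'[ψ](K)`.  Both Selmer groups are finite (tree
theorem `Isogeny.finite_selmerGroup'`), so the `Nat.card`s are the orders.  The tree's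
`casselsFormula_selmerRatio` is the case `deg φ = 3` (`casselsFormula_selmerRatio_of_selmerRatioFormula`).
REFEREED; no `_holds` expected this generation (Poitou–Tate for `E[φ]` + orthogonality of the local
Kummer conditions of `φ`, `φ̂`; Milne I 4.10, 5.1).
[cite: MilneADT2006, Ch. I §7, proof of Thm. 7.3, display (7.3.1) (pp. 98–100) and Notes (p. 101)]
[cite: Cassels1965ArithmeticVIII, Thm. 1.1 with (1.22) and (3.4) (as combined by Klagsbrun–Lemke Oliver 2014 Thm. 3.3; original not held, acq-00278, cite-only)]
[cite: DokchitserDokchitserAnnals2010, §4.1, proof of Thm. 4.3 (held chunk p0011: quote of (7.3.1))]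
[cite: BhargavaKlagsbrunLemkeOliverShnidman2019, §9.1 display (9.2) (chunk p0014 L35–L37) with §2 (chunk p0004 L7–L17, c_𝔭 and c(φ))]
[cite: KlagsbrunLemkeOliver2014TamagawaRatio, Def. 3.1 and Thm. 3.3 (chunk p0005 L26–L35)]
[cite: Shnidman2021QuadraticTwistsRM, Thm. 4.1 and proof (chunk p0010 L13–L24); §3.1 (chunk p0008 L5–L15)] -/
def selmerRatioFormula : Prop :=
  ∀ (K : Type) [Field K] [NumberField K] (V V' : WeierstrassCurve K) [V.IsElliptic] [V'.IsElliptic]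
    (φ : Isogeny V V') (ψ : Isogeny V' V), (∀ P, ψ (φ P) = (φ.degree : ℤ) • P) →
      (selmerRatio φ : ℚ) * Nat.card ψ.selmerGroup * φ.ratKerCard =
        Nat.card φ.selmerGroup * ψ.ratKerCard

end Cassels1965

/-! ## §2 Proved read-outs: the degree-`3` fact, the consumers' `hCF`, `c(φ)c(φ̂) = 1`, quotient form -/

open Cassels1965 (selmerRatioFormula)

/-- **The tree's degree-`3` fact is an instance of the general one**: granted
`Cassels1965.selmerRatioFormula`, BKLOS (9.2) for `3`-isogenies
(`BhargavaKlagsbrunLemkeOliverShnidman2019.casselsFormula_selmerRatio`, including its two finiteness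
clauses, which are the tree's theorem `Isogeny.finite_selmerGroup'`).
[cite: BhargavaKlagsbrunLemkeOliverShnidman2019, §9.1 display (9.2) (chunk p0014 L35–L37)] -/
theorem casselsFormula_selmerRatio_of_selmerRatioFormula (h : selmerRatioFormula) :
    casselsFormula_selmerRatio := by
  intro K _ _ V V' _ _ φ ψ hφ hψφ
  refine ⟨φ.finite_selmerGroup', ψ.finite_selmerGroup', h K V V' φ ψ fun P ↦ ?_⟩
  rw [hφ]
  exact hψφ P

/-- **The consumers' hypothesis `hCF` over `ℚ`, verbatim** (the second input of
`WeierstrassCurve.bsdRHS_eq_of_isIsogenous_of_casselsTate_adjoint_of_casselsFormula` and of its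
`…_functorial_…` / `…_of_casselsTate_of_casselsFormula` siblings in
`BSDQuadraticDescentCasselsSelmerRatioProofs.lean`): Cassels' formula for every `ℚ`-isogeny of
elliptic curves with its dual. [cite: MilneADT2006, Ch. I §7, (7.3.1) (p. 98)] -/
theorem Cassels1965.selmerRatioFormula.rat (h : selmerRatioFormula) :
    ∀ (W W' : WeierstrassCurve ℚ) [W.IsElliptic] [W'.IsElliptic] (φ : Isogeny W W')
      (ψ : Isogeny W' W), (∀ P : W.geomPoints, ψ (φ P) = (φ.degree : ℤ) • P) →
      (selmerRatio φ : ℚ) * Nat.card ψ.selmerGroup * φ.ratKerCard =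
        Nat.card φ.selmerGroup * ψ.ratKerCard :=
  fun W W' _ _ φ ψ hψφ ↦ h ℚ W W' φ ψ hψφ

section Readouts

variable {K : Type} [Field K] [NumberField K] {V V' : WeierstrassCurve K} [V.IsElliptic]
  [V'.IsElliptic]

/-- **Quotient ("Tamagawa ratio") form**: granted Cassels' formula, for a dual pair `(φ, ψ = φ̂)`,
`#Sel_φ(E/K) / #Sel_ψ(E'/K) = c(φ) · #E[φ](K) / #E'[ψ](K)` — Klagsbrun–Lemke Oliver, Def. 3.1
("`𝒯(E/E') = |Sel_φ(E/ℚ)|/|Sel_{φ̂}(E'/ℚ)|`") with Thm. 3.3 (Cassels), where for their `2`-isogenies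
`#E[φ](ℚ) = 2 = #E'[φ̂](ℚ)`; all four cardinalities are positive (`Isogeny.finite_selmerGroup'`,
`Isogeny.ratKerCard_pos`).
[cite: KlagsbrunLemkeOliver2014TamagawaRatio, Def. 3.1 and Thm. 3.3 (chunk p0005 L26–L35)] -/
theorem natCard_selmerGroup_div_eq_of_selmerRatioFormula (h : selmerRatioFormula)
    (φ : Isogeny V V') (ψ : Isogeny V' V) (hψφ : ∀ P, ψ (φ P) = (φ.degree : ℤ) • P) :
    (Nat.card φ.selmerGroup : ℚ) / Nat.card ψ.selmerGroup =
      selmerRatio φ * φ.ratKerCard / ψ.ratKerCard := by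
  have h₁ := h K V V' φ ψ hψφ
  haveI := ψ.finite_selmerGroup'
  have hb : (0 : ℚ) < Nat.card ψ.selmerGroup := by
    exact_mod_cast (Nat.card_pos : 0 < Nat.card ψ.selmerGroup)
  have hd : (0 : ℚ) < ψ.ratKerCard := by exact_mod_cast ψ.ratKerCard_pos
  rw [div_eq_div_iff hb.ne' hd.ne', ← h₁]
  ring

/-- **"`c(φ)c(φ̂) = 1`" for a dual pair of ANY degree** (BKLOS §9.1, p0014 L39: "Cassels' formula …
shows that `c(φ)c(φ̂) = 1`"; Shnidman Cor. 3.5 with `c([n]) = 1`), from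
`Cassels1965.selmerRatioFormula` applied to `(φ, ψ)` and to `(ψ, φ)` (`ψ ∘ φ = [deg φ]`,
`φ ∘ ψ = [deg ψ]`, Silverman III.6.2).  Generalises the tree's degree-`3`
`BhargavaKlagsbrunLemkeOliverShnidman2019.selmerRatio_mul_selmerRatio_eq_one`.
[cite: BhargavaKlagsbrunLemkeOliverShnidman2019, §9.1 (chunk p0014 L39)]
[cite: Shnidman2021QuadraticTwistsRM, Cor. 3.5 (chunk p0008 L45)] -/
theorem selmerRatio_mul_selmerRatio_eq_one_of_dual (h : selmerRatioFormula) (φ : Isogeny V V')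
    (ψ : Isogeny V' V) (hψφ : ∀ P, ψ (φ P) = (φ.degree : ℤ) • P)
    (hφψ : ∀ Q, φ (ψ Q) = (ψ.degree : ℤ) • Q) :
    selmerRatio φ * selmerRatio ψ = 1 := by
  have h₁ := h K V V' φ ψ hψφ
  have h₂ := h K V' V ψ φ hφψ
  haveI := φ.finite_selmerGroup'
  haveI := ψ.finite_selmerGroup'
  have ha : (0 : ℚ) < Nat.card φ.selmerGroup := by
    exact_mod_cast (Nat.card_pos : 0 < Nat.card φ.selmerGroup)
  have hb : (0 : ℚ) < Nat.card ψ.selmerGroup := by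
    exact_mod_cast (Nat.card_pos : 0 < Nat.card ψ.selmerGroup)
  have hc : (0 : ℚ) < φ.ratKerCard := by exact_mod_cast φ.ratKerCard_pos
  have hd : (0 : ℚ) < ψ.ratKerCard := by exact_mod_cast ψ.ratKerCard_pos
  -- `c(φ) · b · c = a · d` and `c(ψ) · a · d = b · c`, all of `a b c d` positive.
  have hbc : (Nat.card ψ.selmerGroup : ℚ) * φ.ratKerCard ≠ 0 := by positivity
  have had : (Nat.card φ.selmerGroup : ℚ) * ψ.ratKerCard ≠ 0 := by positivity
  have e₁ : selmerRatio φ =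
      (Nat.card φ.selmerGroup * ψ.ratKerCard : ℚ) / (Nat.card ψ.selmerGroup * φ.ratKerCard) := by
    rw [eq_div_iff hbc, ← h₁, mul_assoc]
  have e₂ : selmerRatio ψ =
      (Nat.card ψ.selmerGroup * φ.ratKerCard : ℚ) / (Nat.card φ.selmerGroup * ψ.ratKerCard) := by
    rw [eq_div_iff had, ← h₂, mul_assoc]
  rw [e₁, e₂, div_mul_div_comm, mul_comm ((Nat.card ψ.selmerGroup : ℚ) * φ.ratKerCard)]
  exact div_self (mul_ne_zero had hbc)

/-- **The self-dual reading `#Sel_φ = c(φ) · #Sel_{φ̂}` when the rational kernels have the same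
order** (`#E[φ](K) = #E'[φ̂](K)`, e.g. Klagsbrun–Lemke Oliver's `2`-isogenies, where both are `2`):
then `#Sel_φ(E/K) = c(φ) · #Sel_{φ̂}(E'/K)`, i.e. `𝒯(E/E') = c(φ)` (their Thm. 3.3).
[cite: KlagsbrunLemkeOliver2014TamagawaRatio, Thm. 3.3 (chunk p0005 L30–L35)] -/
theorem natCard_selmerGroup_eq_selmerRatio_mul_of_ratKerCard_eq (h : selmerRatioFormula)
    (φ : Isogeny V V') (ψ : Isogeny V' V) (hψφ : ∀ P, ψ (φ P) = (φ.degree : ℤ) • P)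
    (hker : φ.ratKerCard = ψ.ratKerCard) :
    (Nat.card φ.selmerGroup : ℚ) = selmerRatio φ * Nat.card ψ.selmerGroup := by
  have h₁ := h K V V' φ ψ hψφ
  rw [hker] at h₁
  have hd : (ψ.ratKerCard : ℚ) ≠ 0 := by exact_mod_cast ψ.ratKerCard_pos.ne'
  exact (mul_right_cancel₀ hd h₁).symm

end Readouts

end Literature.NumberTheory.EllipticCurves

end
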